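import Literature.NumberTheory.Rogawski1990.RankOneUnstableKappaTelescoping   -- ★ p842978 B-p12 (g29): `neg_pow_mul_inv_pow_mul_depthValue_sub_eq_of_le_of_le` (I-4a telescoping)
import HarnessLib

/-!
# (R1-core) LAYER 2a — EVENTUAL CONSTANCY of `Δ(t)·(O(t) − O(t′))` near the singular sub-torus from the DEPTH EXPANSION, the `Δ`-VALUE and the telescoping
# (road «R1LL-tree», architect A-p16 (g27) RULINGS A-1∕A-6; Rogawski 1990 Lemma 4.9.3 (4.9.2); Labesse–Langlands 1979 §2)

Topic `NumberTheory/Rogawski1990`; namespace `Literature.NumberTheory.Rogawski1990`.  THEOREMS ONLY (no definition, no instance, no notation, no named fact, no `sorry`);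
ABSTRACT over a topological space `X` (the compact torus `Z(t₀)`), its regular locus `U`, and complex-valued data.  Hand (β) = F0P3-p01 (g13).  This is the N-BOOKKEEPING half of
the `hEv` binder of ★ `rankOneUnstable_core_inert_of_eventually` (LAYER 1, p843081): at a point `s` OUTSIDE `U` (singular: the depth `N(t) → ∞` as `t → s` along `U`), if
* (depth expansion, from (I1′) cover ★ p843029 + (α) ★ p843062 + the lattice dictionary + LEMMA U, delivered by the road as `hD`) for `t ∈ U` with `m ≤ N t`:
  `D t = φm t · ((−1)^{N t − m} q^{N t − m}) + Σ_{i<m} (−1)^{N t − i} · (g_q(N t − i) · φ i t)`, `g_q(n) = [n = 0] + [n > 0]·q^{n−1}(q+1)` — the κ-difference of the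
  two colours' orbital expansions in ★ `depthValue_zero_sub_depthValue_one`'s right-hand shape, with coefficient functions `φm`, `φ i` EVENTUALLY CONSTANT at `s`;
* (`Δ`-value, I-4b, delivered as `hΔ`) for `t ∈ U` with `N₁ ≤ N t`: `Δ t = E t · (−1)^{N t} · (q^{N t})⁻¹` with `E` eventually constant at `s`;
* `N t → ∞` at `s` along `U` (`hN`),
then `Δ t · D t` is EVENTUALLY CONSTANT at `s` along `U` — by ★ `neg_pow_mul_inv_pow_mul_depthValue_sub_eq_of_le_of_le` the normalised bracket does not depend on `N ≥ m`.
Together with plain local constancy at the points of `U` (orbital integrals of a locally constant `f` at regular semisimple classes) this is exactly `hEv`.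
§3 (ED. 2): the `hD` binder itself from the finitely many cover pieces of ★ I-5c — each piece an A-p13-shaped parity depth sum at `↑t` (parity `e_k`) and at the stable
partner `τ t` (parity `1 − e_k`), same values by LEMMA U — via ★ `depthValue_zero_sub_depthValue_one` per piece (`sum_sub_eq_depthExpansion_of_paritySums`).
HONEST LABEL: HC_CM is proved only modulo the printed citations (2 remaining named inputs hLiu418, h413) until rung 0 closes; pure bookkeeping, no arithmetic input.

## References
* [Rogawski1990] J. D. Rogawski, *Automorphic Representations of Unitary Groups in Three Variables*, Ann. of Math. Stud. 123 (1990): §4.9 Lemma 4.9.3 (4.9.2) p. 56.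
* [LabesseLanglands1979] J.-P. Labesse, R. P. Langlands, *L-indistinguishability for SL(2)*, Canad. J. Math. 31 (1979): §2.
-/

set_option autoImplicit false

open Filter Topology Finset

namespace Literature.NumberTheory.Rogawski1990

section EventualConstancy

variable {X : Type*} [TopologicalSpace X]

/-- **EVENTUAL CONSTANCY AT A SINGULAR POINT from the depth expansion, the `Δ`-value and `N → ∞`.**  See the module docstring: with `D`, `Δ` as there,
`∃ c, ∀ᶠ t in 𝓝 s, t ∈ U → Δ t * D t = c`.  The constant is `E(s)`-side value times the `N`-independent normalised bracket of ★ `neg_pow_mul_inv_pow_mul_depthValue_sub_eq_of_le_of_le`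
evaluated at `N := max m N₁`. [cite: Rogawski1990, §4.9 Lemma 4.9.3 (4.9.2) p. 56] [cite: LabesseLanglands1979, §2] -/
theorem exists_eventually_mul_eq_const_of_depthExpansion {U : Set X} (s : X) {q : ℕ} (hq : (q : ℂ) ≠ 0) (m N₁ : ℕ)
    (N : X → ℕ) (D Δ E φm : X → ℂ) (φ : ℕ → X → ℂ)
    (hN : ∀ M : ℕ, ∀ᶠ t in 𝓝 s, t ∈ U → M ≤ N t)
    (hE : ∀ᶠ t in 𝓝 s, t ∈ U → E t = E s) (hφm : ∀ᶠ t in 𝓝 s, t ∈ U → φm t = φm s) (hφ : ∀ i ∈ range m, ∀ᶠ t in 𝓝 s, t ∈ U → φ i t = φ i s)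
    (hD : ∀ t ∈ U, m ≤ N t → D t = φm t * ((-1 : ℂ) ^ (N t - m) * (q : ℂ) ^ (N t - m)) +
      ∑ i ∈ range m, (-1 : ℂ) ^ (N t - i) * ((((if N t - i = 0 then 1 else q ^ (N t - i - 1) * (q + 1) : ℕ)) : ℂ) * φ i t))
    (hΔ : ∀ t ∈ U, N₁ ≤ N t → Δ t = E t * ((-1 : ℂ) ^ (N t) * ((q : ℂ) ^ (N t))⁻¹)) :
    ∃ c : ℂ, ∀ᶠ t in 𝓝 s, t ∈ U → Δ t * D t = c := by
  -- the constant: everything frozen at `s`, the bracket read at `N := max m N₁`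
  refine ⟨E s * ((-1 : ℂ) ^ (max m N₁) * ((q : ℂ) ^ (max m N₁))⁻¹ *
      (φm s * ((-1 : ℂ) ^ (max m N₁ - m) * (q : ℂ) ^ (max m N₁ - m)) +
        ∑ i ∈ range m, (-1 : ℂ) ^ (max m N₁ - i) * ((((if max m N₁ - i = 0 then 1 else q ^ (max m N₁ - i - 1) * (q + 1) : ℕ)) : ℂ) * φ i s))), ?_⟩
  have hφ' : ∀ᶠ t in 𝓝 s, t ∈ U → ∀ i ∈ range m, φ i t = φ i s := by
    have h := (Finset.eventually_all (range m)).2 fun i hi => hφ i hi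
    exact h.mono fun t ht htU i hi => ht i hi htU
  filter_upwards [hN (max m N₁), hE, hφm, hφ'] with t htN htE htφm htφ htU
  have hmN : m ≤ N t := (le_max_left m N₁).trans (htN htU)
  have hN₁ : N₁ ≤ N t := (le_max_right m N₁).trans (htN htU)
  rw [hΔ t htU hN₁, hD t htU hmN, htE htU, htφm htU, Finset.sum_congr rfl fun i hi => by rw [htφ htU i hi], mul_assoc,
    neg_pow_mul_inv_pow_mul_depthValue_sub_eq_of_le_of_le hq hmN (le_max_left m N₁) (φm s) (fun i => φ i s)]

/-- **`hEv` ASSEMBLED on all of `X`**: eventual constancy at the points of `U` is given directly (`hreg`: local constancy of `Δ·D` along `U` — orbital integrals of a locally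
constant function at regular semisimple classes and the explicit factor are locally constant there), and at the points outside `U` it is the previous theorem.
[cite: Rogawski1990, §4.9 Lemma 4.9.3 (4.9.2) p. 56] [cite: LabesseLanglands1979, §2] -/
theorem forall_exists_eventually_mul_eq_const_of_depthExpansion {U : Set X} {q : ℕ} (hq : (q : ℂ) ≠ 0) (m N₁ : ℕ)
    (N : X → ℕ) (D Δ E φm : X → ℂ) (φ : ℕ → X → ℂ)
    (hreg : ∀ s ∈ U, ∃ c : ℂ, ∀ᶠ t in 𝓝 s, t ∈ U → Δ t * D t = c)
    (hN : ∀ s ∉ U, ∀ M : ℕ, ∀ᶠ t in 𝓝 s, t ∈ U → M ≤ N t)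
    (hE : ∀ s ∉ U, ∀ᶠ t in 𝓝 s, t ∈ U → E t = E s) (hφm : ∀ s ∉ U, ∀ᶠ t in 𝓝 s, t ∈ U → φm t = φm s)
    (hφ : ∀ s ∉ U, ∀ i ∈ range m, ∀ᶠ t in 𝓝 s, t ∈ U → φ i t = φ i s)
    (hD : ∀ t ∈ U, m ≤ N t → D t = φm t * ((-1 : ℂ) ^ (N t - m) * (q : ℂ) ^ (N t - m)) +
      ∑ i ∈ range m, (-1 : ℂ) ^ (N t - i) * ((((if N t - i = 0 then 1 else q ^ (N t - i - 1) * (q + 1) : ℕ)) : ℂ) * φ i t))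
    (hΔ : ∀ t ∈ U, N₁ ≤ N t → Δ t = E t * ((-1 : ℂ) ^ (N t) * ((q : ℂ) ^ (N t))⁻¹)) :
    ∀ s : X, ∃ c : ℂ, ∀ᶠ t in 𝓝 s, t ∈ U → Δ t * D t = c := by
  intro s
  by_cases hs : s ∈ U
  · exact hreg s hs
  · exact exists_eventually_mul_eq_const_of_depthExpansion s hq m N₁ N D Δ E φm φ (hN s hs) (hE s hs) (hφm s hs) (hφ s hs) hD hΔ

end EventualConstancy

/-! ## §3 (ED. 2) `hD` FROM THE PER-PIECE PARITY DEPTH SUMS — the cover pieces of ★ I-5c, each expanded by (α) with A-p13 (g31)'s ★ counts, summed with the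
opposite parities of `↑t` and its stable partner `τ t`, give exactly the `hD` binder of §1 (★ I-4a `depthValue_zero_sub_depthValue_one` per piece) -/

section Pieces

/-- Reindexing A-p13's level-`m` ball count to ★ I-4a's gluing range: for `m ≤ N`, `{j ≤ N | j ≡ e, j + m ≤ N} = {j < N − m + 1 | j ≡ e}`.
[cite: Rogawski1990, §4.9 Lemma 4.9.3 (4.9.2) p. 56] -/
theorem filter_range_succ_parity_add_le_eq {m N : ℕ} (hmN : m ≤ N) (e : ℕ) :
    (range (N + 1)).filter (fun j => j % 2 = e ∧ j + m ≤ N) = (range (N - m + 1)).filter (fun j => j % 2 = e) := by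
  ext j
  simp only [Finset.mem_filter, Finset.mem_range]
  omega

/-- ONE PIECE in ★ I-4a's currency: `r • (A_e • ψm + Σ_{i<m} B_e(i) • ψ i) = r · (ψm · A_e + Σ_{i<m} [N − i ≡ e]·w(N − i)·ψ i)` for `m ≤ N`, where `A_e`, `B_e` are A-p13's ★
level-`m` ball count `Σ_{j ≤ N, j ≡ e, j + m ≤ N} w(j)` and exact-depth count `[i ≤ N ∧ N − i ≡ e]·w(N − i)` (`ℕ`-scalars as in ★ (α) `integral_conj_eq_smul_depthExpansion`).
[cite: Rogawski1990, §4.9 Lemma 4.9.3 (4.9.2) p. 56] [cite: LabesseLanglands1979, §2] -/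
theorem real_smul_paritySum_eq (q : ℕ) {m N : ℕ} (hmN : m ≤ N) (e : ℕ) (r : ℝ) (ψm : ℂ) (ψ : ℕ → ℂ) :
    r • ((∑ j ∈ (range (N + 1)).filter (fun j => j % 2 = e ∧ j + m ≤ N), (if j = 0 then 1 else q ^ (j - 1) * (q + 1))) • ψm +
        ∑ i ∈ range m, (if i ≤ N ∧ (N - i) % 2 = e then (if N - i = 0 then 1 else q ^ (N - i - 1) * (q + 1)) else 0) • ψ i) =
      (r : ℂ) * (ψm * ((∑ j ∈ (range (N - m + 1)).filter (fun j => j % 2 = e), (if j = 0 then 1 else q ^ (j - 1) * (q + 1)) : ℕ) : ℂ) +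
        ∑ i ∈ range m, (if (N - i) % 2 = e then (((if N - i = 0 then 1 else q ^ (N - i - 1) * (q + 1) : ℕ)) : ℂ) * ψ i else 0)) := by
  rw [Complex.real_smul, filter_range_succ_parity_add_le_eq hmN, nsmul_eq_mul, mul_comm (_ : ℂ) ψm]
  congr 2
  refine Finset.sum_congr rfl fun i hi => ?_
  have hiN : i ≤ N := ((Finset.mem_range.1 hi).le).trans hmN
  by_cases h : (N - i) % 2 = e
  · rw [if_pos ⟨hiN, h⟩, if_pos h, nsmul_eq_mul]
  · rw [if_neg (fun h' => h h'.2), if_neg h, zero_smul]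

/-- THE κ-DIFFERENCE OF ONE PIECE: with `↑t` of parity `e ∈ {0, 1}` and `τ t` of parity `1 − e` (same values `ψm`, `ψ` — LEMMA U), the difference is
`(−1)^e · r · [ψm (−1)^{N−m} q^{N−m} + Σ_{i<m} (−1)^{N−i} w(N−i) ψ i]` (★ I-4a `depthValue_zero_sub_depthValue_one`). [cite: Rogawski1990, §4.9 Lemma 4.9.3 (4.9.2) p. 56]
[cite: LabesseLanglands1979, §2] -/
theorem real_smul_paritySum_sub_eq (q : ℕ) {m N : ℕ} (hmN : m ≤ N) {e : ℕ} (he : e ≤ 1) (r : ℝ) (ψm : ℂ) (ψ : ℕ → ℂ) :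
    r • ((∑ j ∈ (range (N + 1)).filter (fun j => j % 2 = e ∧ j + m ≤ N), (if j = 0 then 1 else q ^ (j - 1) * (q + 1))) • ψm +
        ∑ i ∈ range m, (if i ≤ N ∧ (N - i) % 2 = e then (if N - i = 0 then 1 else q ^ (N - i - 1) * (q + 1)) else 0) • ψ i) -
      r • ((∑ j ∈ (range (N + 1)).filter (fun j => j % 2 = 1 - e ∧ j + m ≤ N), (if j = 0 then 1 else q ^ (j - 1) * (q + 1))) • ψm +
        ∑ i ∈ range m, (if i ≤ N ∧ (N - i) % 2 = 1 - e then (if N - i = 0 then 1 else q ^ (N - i - 1) * (q + 1)) else 0) • ψ i) =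
      (-1 : ℂ) ^ e * (r : ℂ) * (ψm * ((-1 : ℂ) ^ (N - m) * (q : ℂ) ^ (N - m)) +
        ∑ i ∈ range m, (-1 : ℂ) ^ (N - i) * ((((if N - i = 0 then 1 else q ^ (N - i - 1) * (q + 1) : ℕ)) : ℂ) * ψ i)) := by
  rw [real_smul_paritySum_eq q hmN, real_smul_paritySum_eq q hmN, ← mul_sub, ← depthValue_zero_sub_depthValue_one (K := ℂ) q N m ψm ψ]
  rcases Nat.le_one_iff_eq_zero_or_eq_one.1 he with rfl | rfl
  · simp only [Nat.sub_zero, pow_zero, one_mul]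
  · simp only [Nat.sub_self, pow_one, neg_mul, one_mul, ← mul_neg, neg_sub]

/-- **`hD` FROM THE PIECES.**  Finitely many cover pieces `k` (★ I-5c), piece `k` contributing `O k = r_k • (A_{e_k} • ψm_k + Σ_{i<m} B_{e_k}(i) • ψ_k i)` at `↑t` and
`O′ k` = the same with parity `1 − e_k` at the stable partner `τ t` (`r_k = ν(K_k)`; A-p13's ★ counts; LEMMA U for the common values): then
`Σ_k (O k − O′ k) = φm · ((−1)^{N−m} q^{N−m}) + Σ_{i<m} (−1)^{N−i} · (w(N−i) · φ i)` with `φm := Σ_k (−1)^{e_k} r_k ψm_k`, `φ i := Σ_k (−1)^{e_k} r_k ψ_k i` — literally the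
`hD` binder of `exists_eventually_mul_eq_const_of_depthExpansion`. [cite: Rogawski1990, §4.9 Lemma 4.9.3 (4.9.2) p. 56] [cite: LabesseLanglands1979, §2] -/
theorem sum_sub_eq_depthExpansion_of_paritySums {ι : Type*} [Fintype ι] (q : ℕ) {m N : ℕ} (hmN : m ≤ N)
    (e : ι → ℕ) (he : ∀ k, e k ≤ 1) (r : ι → ℝ) (ψm : ι → ℂ) (ψ : ι → ℕ → ℂ) (O O' : ι → ℂ)
    (hO : ∀ k, O k = r k • ((∑ j ∈ (range (N + 1)).filter (fun j => j % 2 = e k ∧ j + m ≤ N), (if j = 0 then 1 else q ^ (j - 1) * (q + 1))) • ψm k +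
      ∑ i ∈ range m, (if i ≤ N ∧ (N - i) % 2 = e k then (if N - i = 0 then 1 else q ^ (N - i - 1) * (q + 1)) else 0) • ψ k i))
    (hO' : ∀ k, O' k = r k • ((∑ j ∈ (range (N + 1)).filter (fun j => j % 2 = 1 - e k ∧ j + m ≤ N), (if j = 0 then 1 else q ^ (j - 1) * (q + 1))) • ψm k +
      ∑ i ∈ range m, (if i ≤ N ∧ (N - i) % 2 = 1 - e k then (if N - i = 0 then 1 else q ^ (N - i - 1) * (q + 1)) else 0) • ψ k i)) :
    ∑ k, (O k - O' k) =
      (∑ k, (-1 : ℂ) ^ (e k) * (r k : ℂ) * ψm k) * ((-1 : ℂ) ^ (N - m) * (q : ℂ) ^ (N - m)) +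
        ∑ i ∈ range m, (-1 : ℂ) ^ (N - i) * ((((if N - i = 0 then 1 else q ^ (N - i - 1) * (q + 1) : ℕ)) : ℂ) *
          ∑ k, (-1 : ℂ) ^ (e k) * (r k : ℂ) * ψ k i) := by
  rw [Finset.sum_congr rfl fun k _ => by rw [hO k, hO' k, real_smul_paritySum_sub_eq q hmN (he k)]]
  simp only [mul_add, Finset.sum_add_distrib, Finset.mul_sum, Finset.sum_mul]
  rw [Finset.sum_comm]
  congr 1
  · exact Finset.sum_congr rfl fun k _ => by ring
  · exact Finset.sum_congr rfl fun i _ => Finset.sum_congr rfl fun k _ => by ring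

end Pieces

end Literature.NumberTheory.Rogawski1990
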